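import Summits.Ventures.Crystal3D.Theorems.StickyWulffConstantTextureLiminfTentBarlowFrames
import Summits.Ventures.Crystal3D.Theorems.StickyWulffConstantTextureLiminfTexShadowSplitDefs
import Summits.Ventures.Crystal3D.Theorems.StickyWulffConstantPolycrystalWulffBoundInclinedLamellarTextureAxis
import Summits.Ventures.Crystal3D.StickySpheres.FccChartLines
import HarnessLib

/-!
# TexShadow — BILAYER-FRAME RIGIDITY for fcc plates: every frame carrying one close-packed bilayer of an affine fcc plate
# carries the plate's LINEAR lattice; hence the `hax` input of `cap_of_admissible` for `BothFcc` co-axial pairs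
# (lane T, crux `TextureLiminf`, stmt-Ventures-19483; line `TexShadow` v6.17 → v6.18, cf-p1 (xlv′)/(xlv⁗))

HONEST FRAMING. Venture `Summits/Ventures/Crystal3D` (cell `crystal3d-full`), helper `--supports` the crux `TextureLiminf`
(stmt-Ventures-19483) of `route-Ventures-StickyWulffConstant`, registered line `TexShadow`.  Rung credit only; F-C1 not moved.
Pure proofs, standard axioms, no new definitions.

WHY.  T's wall parts hand the prover a family of BILAYER frames `A₁ i`, `A₂ j` (`BilayerFramesAt`: the affine lattice
`(A i · + u i) '' fccRef` contains bilayer `i` of the plate) and an admissible table `c` (`BilayerChargeAdmissible A₁ A₂ c m`,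
keyed on the frame pairs `(A₁ i, A₂ j)`), whereas lane F's uniform sibling `CoaxialTwoSlabAdhesionUnifFrom` (debt F-U) is
stated for the two AFFINE PLATE lattices `(P₁· + s₁) '' Λ₀`, `(P₂· + s₂) '' Λ₀` of a `BothFcc` pair
(`exists_affine_fcc_pair_of_bothFcc`).  The bridge is rigidity: an fcc lattice containing a whole close-packed bilayer of
another fcc lattice IS that lattice, so every `A₁ i` presents `P₁ '' fccRef` and every `A₂ j` presents `P₂ '' fccRef`; then
`CoAx`/`SharedAxis` of the frame pairs are those of `(P₁, P₂)`, and the shared axis is unique up to sign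
(`coaxial_axis_eq_or_eq_neg`, poly-p2), which is the `hax` hypothesis of `cap_of_admissible` / `tsum_charge_le_half_sin`
(…TexShadowCoaxialCharge, glue (b)).

* `image_fccRef_subset_of_unitVec` — a linear isometry carrying the twelve unit vectors of `fccRef` into a moved linear lattice
  `A' '' fccRef` carries all of `fccRef` into it (`Λ₀ = ℤu + ℤv + ℤt`, `barlowPos_fcc_linear`);
* **`image_fccRef_eq_of_bilayer_subset`** — two frames `(A, u)`, `(A', u')` whose affine lattices contain ONE bilayer of a moved
  Barlow stacking have the same linear lattice `A '' fccRef = A' '' fccRef` (the bilayer motion of lit's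
  `exists_motion_fccBilayer_zero_eq_moved` + eng's `mapsTo_unitVec_of_subset` / `unitVec_subset_sub`, …TentFrameWulff);
* **`bilayerFrame_image_eq`** — for an affine fcc plate `stacking L s σ = (P· + s) '' Λ₀` and `BilayerFramesAt L s σ A u`:
  `∀ i, A i '' fccRef = P '' fccRef`;
* `sharedAxis_congr`, `coAx_congr` — `SharedAxis m`/`CoAx` depend on the frames only through their linear lattices;
* `image_fccRef_subset_barlow_iff_affine` — affine vs. linear registration: `(P·+t) '' Λ₀ ⊆ (L·+r) '' Barlow σ ↔ P '' Λ₀ ⊆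
  (L· + (r − t)) '' Barlow σ` (F's frame data ↔ T's `SharedAxis`);
* **`frames_equal_or_coaxial_of_sharedAxis`** — the `hax` producer: if the two plate lattices share the axis `m`, then every
  bilayer-frame pair is equal-or-(co-axial with all shared axes `m'` at `√(1−⟪m′,e₃⟫²) ≤ √(1−⟪m,e₃⟫²)`).
WHAT THIS IS NOT: not the `fam*Fcc` closer (waits for F-U/G-U by name, cf-p1 (xlv⁗)); F-C1 not moved.
-/

noncomputable section

namespace Summit.Ventures.Crystal3D.TentCertificate

open Summit.Ventures.Crystal3D
open Literature.MathematicalPhysics.StatisticalMechanics (fccStacking barlowStacking barlowPos barlowLayer constHagg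
  IsHaggSeq barlowPos_mem exists_motion_fccBilayer_zero_eq_moved)
open Summit.Ventures.Crystal3D.Cruxes.TextureLiminf.TexShadow (fccRef stacking bilayer)
open scoped InnerProductSpace

/-- **Span.**  A linear isometry `A` carrying the twelve unit vectors of `fccRef` into the moved linear lattice `A' '' fccRef`
carries ALL of `fccRef` into it (`Λ₀ = ℤu + ℤv + ℤt` with `u, v, t` unit vectors). -/
theorem image_fccRef_subset_of_unitVec {A A' : E3 ≃ₗᵢ[ℝ] E3} (h : ∀ w ∈ unitVec, A w ∈ A' '' fccRef) :
    A '' fccRef ⊆ A' '' fccRef := by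
  have hmem : ∀ {k i j : ℤ}, i ^ 2 + j ^ 2 + k ^ 2 + i * j + i * k + j * k = 1 →
      barlowPos 1 (Real.sqrt (2 / 3)) constHagg k i j ∈ unitVec :=
    fun hq => ⟨barlowPos_mem _ _ _, Theorems.norm_barlowPos_fcc_eq_one hq⟩
  obtain ⟨p₁, hp₁, e₁⟩ := h _ (hmem (k := 0) (i := 1) (j := 0) (by norm_num))
  obtain ⟨p₂, hp₂, e₂⟩ := h _ (hmem (k := 0) (i := 0) (j := 1) (by norm_num))
  obtain ⟨p₃, hp₃, e₃⟩ := h _ (hmem (k := 1) (i := 0) (j := 0) (by norm_num))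
  obtain ⟨k₁, i₁, j₁, rfl⟩ := hp₁
  obtain ⟨k₂, i₂, j₂, rfl⟩ := hp₂
  obtain ⟨k₃, i₃, j₃, rfl⟩ := hp₃
  rintro _ ⟨x, hx, rfl⟩
  obtain ⟨k, i, j, rfl⟩ := hx
  refine ⟨barlowPos 1 (Real.sqrt (2 / 3)) constHagg (i * k₁ + j * k₂ + k * k₃) (i * i₁ + j * i₂ + k * i₃)
    (i * j₁ + j * j₂ + k * j₃), barlowPos_mem _ _ _, ?_⟩
  have hcomb : barlowPos 1 (Real.sqrt (2 / 3)) constHagg (i * k₁ + j * k₂ + k * k₃) (i * i₁ + j * i₂ + k * i₃)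
      (i * j₁ + j * j₂ + k * j₃) =
      (i : ℝ) • barlowPos 1 (Real.sqrt (2 / 3)) constHagg k₁ i₁ j₁ +
        (j : ℝ) • barlowPos 1 (Real.sqrt (2 / 3)) constHagg k₂ i₂ j₂ +
        (k : ℝ) • barlowPos 1 (Real.sqrt (2 / 3)) constHagg k₃ i₃ j₃ := by
    rw [barlowPos_fcc_linear 1 _ k₁, barlowPos_fcc_linear 1 _ k₂, barlowPos_fcc_linear 1 _ k₃,
      barlowPos_fcc_linear 1 _ (i * k₁ + j * k₂ + k * k₃)]
    push_cast
    module
  simp only [hcomb, map_add, LinearIsometryEquiv.map_smul, e₁, e₂, e₃]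
  rw [barlowPos_fcc_linear 1 _ k i j]
  simp only [map_add, LinearIsometryEquiv.map_smul]

/-- **Bilayer-frame rigidity.**  Two frames `(A, u)`, `(A', u')` whose affine fcc lattices both contain ONE close-packed bilayer of
a moved Barlow stacking have the same LINEAR lattice. -/
theorem image_fccRef_eq_of_bilayer_subset {σ : ℤ → ℤ} (hσ : IsHaggSeq σ) (L : E3 ≃ₗᵢ[ℝ] E3) (s : E3) (i : ℤ)
    {A A' : E3 ≃ₗᵢ[ℝ] E3} {u u' : E3} (hA : bilayer L s σ i ⊆ (fun r => A r + u) '' fccRef)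
    (hA' : bilayer L s σ i ⊆ (fun r => A' r + u') '' fccRef) : A '' fccRef = A' '' fccRef := by
  obtain ⟨M, c, hlay, -⟩ := exists_motion_fccBilayer_zero_eq_moved 1 hB hσ L s i
  have hbil := bilayer_eq_image L s σ i
  -- the reference bilayer moved by `(M, c)` lies in the bilayer, hence in both affine lattices
  have hB₀ : ∀ (A₀ : E3 ≃ₗᵢ[ℝ] E3) (u₀ : E3), bilayer L s σ i ⊆ (fun r => A₀ r + u₀) '' fccRef →
      (fun r => M r + c) '' (toRef '' (site '' {n : Site | layer n = 0 ∨ layer n = 1})) ⊆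
        (fun r => A₀ r + u₀) '' fccRef := by
    intro A₀ u₀ h₀
    rintro _ ⟨_, ⟨_, ⟨n, hn, rfl⟩, rfl⟩, rfl⟩
    refine h₀ ?_
    rw [hbil, ← hlay]
    refine ⟨toRef (site n), ?_, rfl⟩
    have h := toRef_site_mem_barlowLayer n
    rcases hn with hn | hn
    · left; rwa [hn] at h
    · right; rw [hn] at h; simpa using h
  have bij := mapsTo_unitVec_of_subset (hB₀ A u hA) unitVec_subset_sub
  have bij' := mapsTo_unitVec_of_subset (hB₀ A' u' hA') unitVec_subset_sub
  have key : ∀ (A₁ A₂ : E3 ≃ₗᵢ[ℝ] E3), Set.BijOn (fun w => A₁.symm (M w)) unitVec unitVec →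
      Set.BijOn (fun w => A₂.symm (M w)) unitVec unitVec → ∀ w ∈ unitVec, A₁ w ∈ A₂ '' fccRef := by
    intro A₁ A₂ h₁ h₂ w hw
    obtain ⟨w₁, hw₁, hw₁e⟩ := h₁.surjOn hw
    have hm : A₂.symm (M w₁) ∈ unitVec := h₂.mapsTo hw₁
    refine ⟨A₂.symm (M w₁), hm.1, ?_⟩
    simp only at hw₁e
    rw [LinearIsometryEquiv.apply_symm_apply, ← hw₁e, LinearIsometryEquiv.apply_symm_apply]
  exact Set.Subset.antisymm (image_fccRef_subset_of_unitVec (key A A' bij bij'))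
    (image_fccRef_subset_of_unitVec (key A' A bij' bij))

end Summit.Ventures.Crystal3D.TentCertificate

namespace Summit.Ventures.Crystal3D.Theorems

open Summit.Ventures.Crystal3D
open Summit.Ventures.Crystal3D.TentCertificate (image_fccRef_eq_of_bilayer_subset bilayer_subset_stacking)
open Literature.MathematicalPhysics.StatisticalMechanics (fccStacking barlowStacking IsHaggSeq)
open Summit.Ventures.Crystal3D.Cruxes.TextureLiminf.TexShadow (E3 e₃ fccRef stacking bilayer SharedAxis CoAx
  BilayerFramesAt)
open scoped InnerProductSpace

/-- **Every bilayer frame of an affine fcc plate carries the plate's linear lattice.**  If `stacking L s σ = (P· + s) '' Λ₀`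
(an fcc plate in either presentation, cf. `exists_affine_fcc_of_const`) and `BilayerFramesAt L s σ A u`, then
`A i '' fccRef = P '' fccRef` for every `i`. -/
theorem bilayerFrame_image_eq {σ : ℤ → ℤ} (hσ : IsHaggSeq σ) {L P : E3 ≃ₗᵢ[ℝ] E3} {s : E3}
    (hS : stacking L s σ = (fun q => P q + s) '' fccStacking 1 (Real.sqrt (2 / 3)))
    {A : ℤ → (E3 ≃ₗᵢ[ℝ] E3)} {u : ℤ → E3} (hfr : BilayerFramesAt L s σ A u) (i : ℤ) :
    A i '' fccRef = P '' fccRef :=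
  image_fccRef_eq_of_bilayer_subset hσ L s i (hfr i)
    (fun y hy => by have h := bilayer_subset_stacking L s σ i hy; rw [hS] at h; exact h)

/-- `SharedAxis m` depends on the two frames only through their linear lattices. -/
theorem sharedAxis_congr {m : E3} {A A' B B' : E3 ≃ₗᵢ[ℝ] E3} (hA : A '' fccRef = A' '' fccRef)
    (hB : B '' fccRef = B' '' fccRef) : SharedAxis m A B ↔ SharedAxis m A' B' := by
  unfold SharedAxis
  rw [hA, hB]

/-- `CoAx` depends on the two frames only through their linear lattices. -/
theorem coAx_congr {A A' B B' : E3 ≃ₗᵢ[ℝ] E3} (hA : A '' fccRef = A' '' fccRef) (hB : B '' fccRef = B' '' fccRef) :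
    CoAx A B ↔ CoAx A' B' := by
  unfold CoAx
  simp only [sharedAxis_congr hA hB]

/-- **Affine vs. linear registration** (F's frame data ↔ T's `SharedAxis`): the affine plate `(P· + t) '' Λ₀` lies in the moved
Barlow stacking `(L· + r) '' Barlow σ` iff the linear lattice `P '' Λ₀` lies in `(L· + (r − t)) '' Barlow σ`. -/
theorem image_fccRef_subset_barlow_iff_affine (P L : E3 ≃ₗᵢ[ℝ] E3) (t r : E3) (σ : ℤ → ℤ) :
    (fun q => P q + t) '' fccStacking 1 (Real.sqrt (2 / 3)) ⊆
        (fun q => L q + r) '' barlowStacking 1 (Real.sqrt (2 / 3)) σ ↔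
      P '' fccStacking 1 (Real.sqrt (2 / 3)) ⊆
        (fun q => L q + (r - t)) '' barlowStacking 1 (Real.sqrt (2 / 3)) σ := by
  constructor
  · intro h
    rintro _ ⟨x, hx, rfl⟩
    obtain ⟨q, hq, hqe⟩ := h ⟨x, hx, rfl⟩
    refine ⟨q, hq, ?_⟩
    simp only at hqe ⊢
    rw [← add_sub_assoc, hqe, add_sub_cancel_right]
  · intro h
    rintro _ ⟨x, hx, rfl⟩
    obtain ⟨q, hq, hqe⟩ := h ⟨x, hx, rfl⟩
    refine ⟨q, hq, ?_⟩
    simp only at hqe ⊢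
    rw [← hqe]
    abel

/-- **The `hax` input of `cap_of_admissible` for a `BothFcc` pair.**  If both plates are affine fcc lattices
(`stacking Lₖ sₖ σₖ = (Pₖ· + sₖ) '' Λ₀`) whose LINEAR lattices share the stacking axis `m` (`SharedAxis m P₁ P₂`), then every pair
of bilayer frames is either EQUAL (same linear lattice) or CO-AXIAL with ALL its shared axes `m'` at
`√(1 − ⟪m', e₃⟫²) ≤ √(1 − ⟪m, e₃⟫²)` (indeed `m' = ±m`, `coaxial_axis_eq_or_eq_neg`). -/
theorem frames_equal_or_coaxial_of_sharedAxis {σ₁ σ₂ : ℤ → ℤ} (hσ₁ : IsHaggSeq σ₁) (hσ₂ : IsHaggSeq σ₂)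
    {L₁ L₂ P₁ P₂ : E3 ≃ₗᵢ[ℝ] E3} {s₁ s₂ : E3}
    (hS₁ : stacking L₁ s₁ σ₁ = (fun q => P₁ q + s₁) '' fccStacking 1 (Real.sqrt (2 / 3)))
    (hS₂ : stacking L₂ s₂ σ₂ = (fun q => P₂ q + s₂) '' fccStacking 1 (Real.sqrt (2 / 3)))
    {A₁ A₂ : ℤ → (E3 ≃ₗᵢ[ℝ] E3)} {u₁ u₂ : ℤ → E3}
    (hfr₁ : BilayerFramesAt L₁ s₁ σ₁ A₁ u₁) (hfr₂ : BilayerFramesAt L₂ s₂ σ₂ A₂ u₂)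
    {m : E3} (hm : SharedAxis m P₁ P₂) :
    ∀ i j : ℤ, A₁ i '' fccRef = A₂ j '' fccRef ∨
      (CoAx (A₁ i) (A₂ j) ∧ ∀ m' : E3, SharedAxis m' (A₁ i) (A₂ j) →
        Real.sqrt (1 - ⟪m', e₃⟫_ℝ ^ 2) ≤ Real.sqrt (1 - ⟪m, e₃⟫_ℝ ^ 2)) := by
  intro i j
  have h₁ := bilayerFrame_image_eq hσ₁ hS₁ hfr₁ i
  have h₂ := bilayerFrame_image_eq hσ₂ hS₂ hfr₂ j
  by_cases heq : P₁ '' fccRef = P₂ '' fccRef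
  · left; rw [h₁, h₂, heq]
  · right
    refine ⟨(coAx_congr h₁ h₂).2 ⟨m, hm⟩, fun m' hm' => ?_⟩
    have hm'' : SharedAxis m' P₁ P₂ := (sharedAxis_congr h₁ h₂).1 hm'
    obtain ⟨L, r₁, r₂, σ, σ', hσ, hσ', hLe, hc₁, hc₂⟩ := hm
    obtain ⟨L', r₁', r₂', τ, τ', hτ, hτ', hLe', hc₁', hc₂'⟩ := hm''
    have hax := coaxial_axis_eq_or_eq_neg (A := P₁) (B := P₂) (m := m) (m' := m')
      ⟨L, r₁, r₂, σ, σ', hσ, hσ', hLe, hc₁, hc₂⟩ ⟨L', r₁', r₂', τ, τ', hτ, hτ', hLe', hc₁', hc₂'⟩ heq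
    rcases hax with rfl | rfl
    · exact le_rfl
    · rw [inner_neg_left, neg_sq]

end Summit.Ventures.Crystal3D.Theorems

end
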